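import Literature.Analysis.FluidPDE.SawtoothCascade
import Mathlib.LinearAlgebra.Matrix.Notation

/-!
# K2 lane (route-2 `SawtoothPulseCascade`, crux dir `K1LocalisedCascade`): the periodised line kernel at `0` and `½` IS the tree's `Σ₀`, `S_β`

Helper file of the K2 lane (ACL item stmt-AnomalousDissipation-19491), serving planner p4's typed slot map
`Cruxes/K1LocalisedCascade/K2TypedSlotMap.lean` (targets `KernelAtZero`, `KernelAtHalf`, `BlockSq`). The periodised Biot–Savart line kernel of the
family `(a, β)` is `G_{a,β}(y) = Σ_{n∈ℤ} e^{2πiβn} g(y − n)`, `g(y) = −e^{−κ|y|}/(2κ)`, `κ = 2πa`; on `y = r ∈ [0,1)` the lattice sum is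
`G(r) = −(e^{−κr}/(1 − z̄q) + z e^{κ(r−1)}/(1 − zq))/(2κ)`, `z = e^{2πiβ}`, `q = e^{−κ}` (BOTH branches `n ≤ 0` and `n ≥ 1` carry the minus sign).
Proved here, for `a > 0`, with the kernel SPELLED OUT at `r = 0` and `r = ½` (the Cruxes file is not importable under `Theorems/`):
* `twoPi_lineKernel_zero`: `2π·G(0) = sawSigma0 a β`;
* `twoPi_conj_lineKernel_half`: `2π·conj G(½) = sawS a β` (the tree's lattice sum uses the opposite Bloch sign);
* `blockX_sq_of`: for any `G0, Gh` with `2π G0 = Σ₀`, `2π conj Gh = S`: `(2πia·[[−¼ − 2G0, −2Gh],[2 conj Gh, ¼ + 2G0]])² = −(a² c²(a,β))·1`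
  (`c² = sawC2`; p4's `BlockSq` with `khLam = −a²·sawC2`).
FINDING (for p4, recorded in the seat's memo): as typed in `K2TypedSlotMap.lean` (5cbecd5f08b7) the closed form reads
`(-(e^{−κr}) / (1 − z̄q) + e^{κ(r−1)} z/(1 − zq))/(2κ)` — Lean parses `-A / B + C` as `(-A)/B + C`, so the `n ≥ 1` branch has the wrong sign there and
`KernelAtZero`/`KernelAtHalf` are false for that term (e.g. `a = 0.3, β = 0.1`: `|2πG(0) − Σ₀| = 0.574`); with the sign of this file they hold.
No definitions; no statement about the crux. [cite: Drazin2002, §8.3 (8.36)–(8.38)] [problem: turb]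
-/

-- `Summit.<Summit>.<Problem>`: single-conjunct summit, the duplicate namespace segment is deliberate.
set_option linter.dupNamespace false

noncomputable section

namespace Summit.AnomalousDissipation.AnomalousDissipation.Theorems.SawtoothPulseCascade.K2PhaseBudget

open Set Real Complex Literature.Analysis.FluidPDE.SawtoothCascade

/-! ## §1 The Bloch factor `z = e^{2πiβ}` -/

/-- `z z̄ = 1` for `z = e^{2πiβ}`. [folklore] -/
theorem blochZ_mul_conj (β : ℝ) :
    Complex.exp (((2 * Real.pi * β : ℝ) : ℂ) * Complex.I) * starRingEnd ℂ (Complex.exp (((2 * Real.pi * β : ℝ) : ℂ) * Complex.I)) = 1 := by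
  rw [Complex.mul_conj, Complex.normSq_eq_norm_sq, Complex.norm_exp_ofReal_mul_I]
  simp

/-- `z + z̄ = 2 cos 2πβ` for `z = e^{2πiβ}`. [folklore] -/
theorem blochZ_add_conj (β : ℝ) :
    Complex.exp (((2 * Real.pi * β : ℝ) : ℂ) * Complex.I) + starRingEnd ℂ (Complex.exp (((2 * Real.pi * β : ℝ) : ℂ) * Complex.I)) =
      ((2 * Real.cos (2 * Real.pi * β) : ℝ) : ℂ) := by
  rw [Complex.add_conj, Complex.exp_ofReal_mul_I_re]

/-- `1 − w q ≠ 0` whenever `‖w‖ = 1` and `0 ≤ q < 1`. [folklore] -/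
theorem one_sub_mul_ne_zero {w : ℂ} {q : ℝ} (hw : ‖w‖ = 1) (hq0 : 0 ≤ q) (hq : q < 1) : 1 - w * (q : ℂ) ≠ 0 := by
  intro h
  have h1 : w * (q : ℂ) = 1 := by linear_combination -h
  have h2 : ‖w * (q : ℂ)‖ = 1 := by rw [h1]; simp
  rw [norm_mul, hw, one_mul, Complex.norm_real, Real.norm_eq_abs, abs_of_nonneg hq0] at h2
  linarith

/-! ## §2 The kernel at `0` and at `½` -/

/-- **`2π G_{a,β}(0) = Σ₀(a, β)`** (`a > 0`): the periodised line kernel at the sheet's own line is the tree's diagonal lattice sum;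
kernel spelled out at `r = 0` (`e^{−κ·0} = 1`, `e^{κ(0−1)} = q`). [cite: Drazin2002, §8.3 (8.36)–(8.38)] -/
theorem twoPi_lineKernel_zero {a : ℝ} (ha : 0 < a) (β : ℝ) :
    (2 * Real.pi : ℂ) *
        (-((1 : ℂ) / (1 - starRingEnd ℂ (Complex.exp (((2 * Real.pi * β : ℝ) : ℂ) * Complex.I)) * (Real.exp (-(2 * Real.pi * a)) : ℂ)) +
            (Real.exp (-(2 * Real.pi * a)) : ℂ) * Complex.exp (((2 * Real.pi * β : ℝ) : ℂ) * Complex.I) /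
              (1 - Complex.exp (((2 * Real.pi * β : ℝ) : ℂ) * Complex.I) * (Real.exp (-(2 * Real.pi * a)) : ℂ))) /
          (2 * (2 * Real.pi * a) : ℂ)) =
      ((sawSigma0 a β : ℝ) : ℂ) := by
  set z : ℂ := Complex.exp (((2 * Real.pi * β : ℝ) : ℂ) * Complex.I) with hz
  set q : ℝ := Real.exp (-(2 * Real.pi * a)) with hq
  have hzz : z * starRingEnd ℂ z = 1 := blochZ_mul_conj β
  have hzc : z + starRingEnd ℂ z = ((2 * Real.cos (2 * Real.pi * β) : ℝ) : ℂ) := blochZ_add_conj β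
  have hzn : ‖z‖ = 1 := Complex.norm_exp_ofReal_mul_I _
  have hzn' : ‖starRingEnd ℂ z‖ = 1 := by rw [Complex.norm_conj]; exact hzn
  have hq0 : 0 < q := Real.exp_pos _
  have hq1 : q < 1 := by
    have h := Real.exp_lt_exp.2 (show -(2 * Real.pi * a) < 0 by have := Real.pi_pos; nlinarith)
    rwa [Real.exp_zero] at h
  have hd1 : 1 - starRingEnd ℂ z * (q : ℂ) ≠ 0 := one_sub_mul_ne_zero hzn' hq0.le hq1
  have hd2 : 1 - z * (q : ℂ) ≠ 0 := one_sub_mul_ne_zero hzn hq0.le hq1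
  have hDr : 0 < 1 - 2 * q * Real.cos (2 * Real.pi * β) + q ^ 2 := by
    nlinarith [Real.cos_le_one (2 * Real.pi * β), hq0, hq1]
  have hden : (1 - starRingEnd ℂ z * (q : ℂ)) * (1 - z * (q : ℂ)) = ((1 - 2 * q * Real.cos (2 * Real.pi * β) + q ^ 2 : ℝ) : ℂ) := by
    have e : ((1 - 2 * q * Real.cos (2 * Real.pi * β) + q ^ 2 : ℝ) : ℂ) = 1 - (q : ℂ) * ((2 * Real.cos (2 * Real.pi * β) : ℝ) : ℂ) + (q : ℂ) ^ 2 := by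
      push_cast; ring
    rw [e, ← hzc]
    linear_combination ((q : ℂ) ^ 2) * hzz
  have key : -((1 : ℂ) / (1 - starRingEnd ℂ z * (q : ℂ)) + (q : ℂ) * z / (1 - z * (q : ℂ))) =
      -(((1 - q ^ 2 : ℝ) : ℂ)) / (((1 - 2 * q * Real.cos (2 * Real.pi * β) + q ^ 2 : ℝ) : ℂ)) := by
    rw [← hden]
    have hd1' : 1 - (q : ℂ) * starRingEnd ℂ z ≠ 0 := by rwa [mul_comm] at hd1
    have hd2' : 1 - (q : ℂ) * z ≠ 0 := by rwa [mul_comm] at hd2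
    push_cast
    field_simp
    linear_combination ((q : ℂ) ^ 2) * hzz
  rw [key]
  have hSig : sawSigma0 a β = -(1 - q ^ 2) / (2 * a * (1 - 2 * q * Real.cos (2 * Real.pi * β) + q ^ 2)) := by
    simp only [sawSigma0, sawQ, hq]
  rw [hSig]
  have hDc : (((1 - 2 * q * Real.cos (2 * Real.pi * β) + q ^ 2 : ℝ) : ℂ)) ≠ 0 := by exact_mod_cast hDr.ne'
  have ha' : (a : ℂ) ≠ 0 := by exact_mod_cast ha.ne'
  have hπ : (Real.pi : ℂ) ≠ 0 := by exact_mod_cast Real.pi_ne_zero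
  push_cast
  field_simp

/-- **`2π conj G_{a,β}(½) = S_β(a)`** (`a > 0`): the kernel at the partner line, conjugated (opposite Bloch sign in the tree's lattice sum),
is the tree's off-diagonal lattice sum; kernel spelled out at `r = ½` (`e^{−κ/2} = e^{κ(½−1)} = e^{−aπ}`). [cite: Drazin2002, §8.3 (8.36)–(8.38)] -/
theorem twoPi_conj_lineKernel_half {a : ℝ} (ha : 0 < a) (β : ℝ) :
    (2 * Real.pi : ℂ) * starRingEnd ℂ
        (-((Real.exp (-(a * Real.pi)) : ℂ) / (1 - starRingEnd ℂ (Complex.exp (((2 * Real.pi * β : ℝ) : ℂ) * Complex.I)) * (Real.exp (-(2 * Real.pi * a)) : ℂ)) +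
            (Real.exp (-(a * Real.pi)) : ℂ) * Complex.exp (((2 * Real.pi * β : ℝ) : ℂ) * Complex.I) /
              (1 - Complex.exp (((2 * Real.pi * β : ℝ) : ℂ) * Complex.I) * (Real.exp (-(2 * Real.pi * a)) : ℂ))) /
          (2 * (2 * Real.pi * a) : ℂ)) =
      sawS a β := by
  set z : ℂ := Complex.exp (((2 * Real.pi * β : ℝ) : ℂ) * Complex.I) with hz
  have hzn : ‖z‖ = 1 := Complex.norm_exp_ofReal_mul_I _
  have hzn' : ‖starRingEnd ℂ z‖ = 1 := by rw [Complex.norm_conj]; exact hzn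
  have hq0 : 0 < Real.exp (-(2 * Real.pi * a)) := Real.exp_pos _
  have hq1 : Real.exp (-(2 * Real.pi * a)) < 1 := by
    have h := Real.exp_lt_exp.2 (show -(2 * Real.pi * a) < 0 by have := Real.pi_pos; nlinarith)
    rwa [Real.exp_zero] at h
  have hd1 : 1 - starRingEnd ℂ z * (Real.exp (-(2 * Real.pi * a)) : ℂ) ≠ 0 := one_sub_mul_ne_zero hzn' hq0.le hq1
  have hd2 : 1 - z * (Real.exp (-(2 * Real.pi * a)) : ℂ) ≠ 0 := one_sub_mul_ne_zero hzn hq0.le hq1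
  have hQ : ((sawQ a : ℝ) : ℂ) = (Real.exp (-(2 * Real.pi * a)) : ℂ) := by simp [sawQ]
  have hS : sawS a β = (-(((Real.exp (-(a * Real.pi)) / (2 * a) : ℝ) : ℂ))) *
      (1 / (1 - z * (Real.exp (-(2 * Real.pi * a)) : ℂ)) + starRingEnd ℂ z / (1 - starRingEnd ℂ z * (Real.exp (-(2 * Real.pi * a)) : ℂ))) := by
    simp only [sawS, hQ, hz]
  rw [hS]
  have ha' : (a : ℂ) ≠ 0 := by exact_mod_cast ha.ne'
  have hπ : (Real.pi : ℂ) ≠ 0 := by exact_mod_cast Real.pi_ne_zero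
  simp only [map_neg, map_div₀, map_add, map_mul, map_sub, map_one, Complex.conj_ofReal, Complex.conj_conj, map_ofNat]
  push_cast
  field_simp

/-! ## §3 The block squares to a scalar -/

/-- **`X² = −(a² c²)·1`** for the typed Kelvin–Helmholtz block `X = 2πia·[[−¼ − 2G0, −2Gh],[2 conj Gh, ¼ + 2G0]]` as soon as
`2π G0 = Σ₀(a,β)` and `2π conj Gh = S_β(a)` (`c² = sawC2 a β = (π/2 + 2Σ₀)² − 4|S|²`): p4's `BlockSq`, the matrix form of `khBlock_sq`.
[cite: Drazin2002, §8.3 (8.36)–(8.38)] -/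
theorem blockX_sq_of {a β : ℝ} {G0 Gh : ℂ} (h0 : (2 * Real.pi : ℂ) * G0 = ((sawSigma0 a β : ℝ) : ℂ))
    (hh : (2 * Real.pi : ℂ) * starRingEnd ℂ Gh = sawS a β) :
    ((((2 * Real.pi * a : ℝ) : ℂ) * Complex.I) • !![-(1 / 4 : ℂ) - 2 * G0, -2 * Gh; 2 * starRingEnd ℂ Gh, (1 / 4 : ℂ) + 2 * G0]) *
        ((((2 * Real.pi * a : ℝ) : ℂ) * Complex.I) • !![-(1 / 4 : ℂ) - 2 * G0, -2 * Gh; 2 * starRingEnd ℂ Gh, (1 / 4 : ℂ) + 2 * G0]) =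
      ((-(a ^ 2 * sawC2 a β) : ℝ) : ℂ) • (1 : Matrix (Fin 2) (Fin 2) ℂ) := by
  have hS : ((Complex.normSq (sawS a β) : ℝ) : ℂ) = ((2 * Real.pi : ℂ) * starRingEnd ℂ Gh) * ((2 * Real.pi : ℂ) * Gh) := by
    rw [← Complex.mul_conj, ← hh]
    simp only [map_mul, map_ofNat, Complex.conj_ofReal, Complex.conj_conj]
  have hc : ((-(a ^ 2 * sawC2 a β) : ℝ) : ℂ) =
      -((a : ℂ) ^ 2 * ((((Real.pi : ℂ)) / 2 + 2 * ((2 * Real.pi : ℂ) * G0)) ^ 2 -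
        4 * (((2 * Real.pi : ℂ) * starRingEnd ℂ Gh) * ((2 * Real.pi : ℂ) * Gh)))) := by
    rw [← hS, h0]
    simp only [sawC2]
    push_cast
    ring
  rw [hc, Matrix.smul_mul, Matrix.mul_smul, smul_smul]
  ext i j
  fin_cases i <;> fin_cases j <;> simp [Matrix.smul_apply] <;>
    first
      | linear_combination ((4 : ℂ) * (Real.pi : ℂ) ^ 2 * (a : ℂ) ^ 2 *
          ((1 / 4 + 2 * G0) ^ 2 - 4 * Gh * starRingEnd ℂ Gh)) * Complex.I_sq
      | exact Or.inr (by ring)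

end Summit.AnomalousDissipation.AnomalousDissipation.Theorems.SawtoothPulseCascade.K2PhaseBudget

end
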